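import Summits.NavierStokesRegularity.FluidComputer.CrayaCoordinates

/-!
# Reality in Craya coordinates (first layer of (F4)): frame parity and conjugate symmetry
(instab3 g5 — implementation 1 of the skew-cut X0 certifier, cell `ns-blowup`, 2026-08-26)

HONEST FRAMING (human ruling D-0035): nothing here is a claim about Navier–Stokes blow-up.
WHAT THIS IS NOT: not NS evidence; MODEL-lane coordinate bookkeeping. The certifier (implementation 1,
INSTAB3-METHOD §2) works with REAL matrices in the real basis `ψ_{k,b,c/s} = √2 e_b(k) cos / sin(k·x)`;
the step (F4) of the X0 chain (`SkewCutGalerkinReality`) converts real quadratic-form certificates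
into the complex form. This file is the first layer of that dictionary in the Craya coordinates of
`CrayaFrames` / `CrayaCoordinates`:

* frame parity `crayaVec_neg_zero` / `crayaVec_neg_one`: `e₁(−k) = −e₁(k)`, `e₂(−k) = e₂(k)`
  (`|E_a(−k)| = |E_a(k)|`, `crayaLen_neg`); the frames are real (`conjVec_crayaVec`);
* `crayaSynth_neg`, `conjVec_crayaSynth`;
* **`isConjSymm_crayaSynth_iff`**: `crayaSynth v` is conjugate symmetric (`c(−k) = conj c(k)`, the
  reality of a Fourier coefficient family, `IsConjSymm`) iff `v(−k,0) = −conj v(k,0)` and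
  `v(−k,1) = conj v(k,1)` for all `k ≠ 0`.

Mathlib + tree files only; no definitions.
-/

noncomputable section

open scoped BigOperators InnerProductSpace ComplexConjugate Matrix
open Finset Matrix

namespace Summit.NavierStokesRegularity.FluidComputer.CrayaFrames

open Literature.Analysis.FluidPDE Literature.Analysis.FluidPDE.SteadyLattice
open Literature.Analysis.FunctionSpaces Literature.Analysis.FunctionSpaces.Torus

/-! ### Reality (F4), first layer: frame parity and conjugate symmetry in Craya coordinates -/

/-- The frame lengths are even in `k`: `|E_a(−k)| = |E_a(k)|`. -/
theorem crayaLen_neg (a : Fin 2) (k : Fin 3 → ℤ) : crayaLen a (-k) = crayaLen a k := by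
  rw [crayaLen, crayaLen, crayaInt_neg]
  fin_cases a
  · simp [freqNormSq_neg]
  · simp

/-- **Frame parity**: `e₁(−k) = −e₁(k)` (the first unit frame vector is odd). -/
theorem crayaVec_neg_zero (k : Fin 3 → ℤ) : crayaVec 0 (-k) = -crayaVec 0 k := by
  ext j
  rw [PiLp.neg_apply, crayaVec_apply, crayaVec_apply, crayaLen_neg, crayaInt_neg]
  simp

/-- **Frame parity**: `e₂(−k) = e₂(k)` (the second unit frame vector is even). -/
theorem crayaVec_neg_one (k : Fin 3 → ℤ) : crayaVec 1 (-k) = crayaVec 1 k := by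
  ext j
  rw [crayaVec_apply, crayaVec_apply, crayaLen_neg, crayaInt_neg]
  simp

/-- The frame vectors are real: `conj e_a(k) = e_a(k)`. -/
theorem conjVec_crayaVec (a : Fin 2) (k : Fin 3 → ℤ) : EuclideanSpace.conjVec (crayaVec a k) = crayaVec a k := by
  ext j
  rw [EuclideanSpace.conjVec_apply, conj_crayaVec_apply]

/-- Conjugation of a synthesised vector: `conj c(k) = ∑_a conj(v(k,a)) e_a(k)` (`k ≠ 0`). -/
theorem conjVec_crayaSynth (v : CrayaIdx → ℂ) {k : Fin 3 → ℤ} (hk : k ≠ 0) :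
    EuclideanSpace.conjVec (crayaSynth v k) = ∑ a, (starRingEnd ℂ) (v (⟨k, hk⟩, a)) • crayaVec a k := by
  rw [crayaSynth_of_ne_zero v hk, EuclideanSpace.conjVec_sum]
  exact Finset.sum_congr rfl fun a _ => by rw [EuclideanSpace.conjVec_smul, conjVec_crayaVec]

/-- The synthesised vector at `−k` in the frame at `k`: `c(−k) = −v(−k,0) e₁(k) + v(−k,1) e₂(k)`. -/
theorem crayaSynth_neg (v : CrayaIdx → ℂ) {k : Fin 3 → ℤ} (hk : k ≠ 0) :
    crayaSynth v (-k) = (-v (⟨-k, neg_ne_zero.mpr hk⟩, 0)) • crayaVec 0 k +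
      v (⟨-k, neg_ne_zero.mpr hk⟩, 1) • crayaVec 1 k := by
  rw [crayaSynth_of_ne_zero v (neg_ne_zero.mpr hk), Fin.sum_univ_two, crayaVec_neg_zero, crayaVec_neg_one,
    smul_neg, neg_smul]

/-- **Conjugate symmetry in Craya coordinates (reality).** The synthesised family `c = crayaSynth v` is
conjugate symmetric (`c(−k) = conj c(k)`, the reality condition of a Fourier coefficient family) iff
the coordinates satisfy `v(−k, 0) = −conj v(k, 0)` and `v(−k, 1) = conj v(k, 1)` for all `k ≠ 0`
(odd first frame vector, even second frame vector) — the relation behind the certifier's REAL basis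
`ψ_{k,b,c/s} = √2 e_b(k) cos / sin(k·x)` (INSTAB3-METHOD §2). -/
theorem isConjSymm_crayaSynth_iff (v : CrayaIdx → ℂ) :
    IsConjSymm (crayaSynth v) ↔ ∀ (k : Fin 3 → ℤ) (hk : k ≠ 0),
      v (⟨-k, neg_ne_zero.mpr hk⟩, 0) = -(starRingEnd ℂ) (v (⟨k, hk⟩, 0)) ∧
        v (⟨-k, neg_ne_zero.mpr hk⟩, 1) = (starRingEnd ℂ) (v (⟨k, hk⟩, 1)) := by
  constructor
  · intro h k hk
    have hk' := h k
    rw [crayaSynth_neg v hk, conjVec_crayaSynth v hk, Fin.sum_univ_two] at hk'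
    -- read off the two coefficients with the orthonormal frame
    have h0 := congrArg (fun X => ⟪crayaVec 0 k, X⟫_ℂ) hk'
    have h1 := congrArg (fun X => ⟪crayaVec 1 k, X⟫_ℂ) hk'
    simp only [inner_add_right, inner_smul_right, inner_crayaVec_crayaVec hk] at h0 h1
    simp at h0 h1
    exact ⟨by rw [← h0, neg_neg], h1⟩
  · intro h k
    by_cases hk : k = 0
    · subst hk; simp [crayaSynth_zero_freq, EuclideanSpace.conjVec_zero]
    · obtain ⟨h0, h1⟩ := h k hk
      rw [crayaSynth_neg v hk, conjVec_crayaSynth v hk, Fin.sum_univ_two, h0, h1, neg_neg]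

end Summit.NavierStokesRegularity.FluidComputer.CrayaFrames

end
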